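import Summits.MatrixMultiplication.OmegaCensus.SmallFormats.MatMul225RankOverRingsToF3
import Summits.MatrixMultiplication.OmegaCensus.SmallFormats.MatMul22nRankGF3Ladder2
import HarnessLib

/-!
# ω-census family (a): the `𝔽₃` ladder for `⟨2,2,n⟩` transfers to every commutative ring mapping to `𝔽₃` — in particular to the dyadic integers `ℤ[1/2]`

Cell `pub-omega` (unit `pub-omega-tensor`, gen 37), topic `Summits/MatrixMultiplication/OmegaCensus` (sub-folder `SmallFormats`). Framing
(verbatim): lottery ticket; floor = certified bounds/negative ranges. HONEST FRAMING: bookkeeping by base change (Bläser 1999 §5 (10),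
`tensorRank_matMulTensor_map_le`): every kernel LOWER bound of the `𝔽₃` ladder (`tensorRank_matMulTensor_22n_gf3_ladder_5_12'`, the
Alekseev–Nazarov floor `⌈36n/11⌉`, Alekseev's `3n+2`) holds over any commutative ring `K` with a homomorphism `K → 𝔽₃`, and Hopcroft–Kerr's
`⌈7n/2⌉` schemes are integral, so the WINDOWS transfer verbatim. The case that matters for searches is `K = ℤ[1/2]` (no homomorphism to `𝔽₂`,
so Hopcroft–Kerr's `𝔽₂` theorem says nothing there; the record schemes of the AlphaTensor / flip-graph literature have dyadic coefficients):
`R_{ℤ[1/2]}(⟨2,2,5⟩) = 18`, `R_{ℤ[1/2]}(⟨2,2,6⟩) = 21`, `R_{ℤ[1/2]}(⟨2,2,7⟩) ∈ [24,25]`, …. Nothing here is a bound on `ω`.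
-/

namespace Summit.MatrixMultiplication.OmegaCensus.SmallFormats

open Literature.Computability.AlgebraicComplexity

/-- **The `𝔽₃` kernel window transfers**: for every commutative ring `K` with `K → 𝔽₃` and every `n ≥ 4`,
`max(3n+2, ⌈36n/11⌉) ≤ R_K(⟨2,2,n⟩) ≤ ⌈7n/2⌉`. -/
theorem tensorRank_matMulTensor_22n_window_of_ringHom_zmod3 {K : Type*} [CommRing K] (f : K →+* ZMod 3)
    (n : ℕ) (hn : 4 ≤ n) :
    max (3 * n + 2) ((36 * n + 10) / 11) ≤ tensorRank (matMulTensor K 2 2 n) ∧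
      tensorRank (matMulTensor K 2 2 n) ≤ (7 * n + 1) / 2 := by
  have h1 := tensorRank_matMulTensor_map_le f 2 2 n
  have h2 := (tensorRank_matMulTensor_22n_gf3_window n hn).1
  exact ⟨h2.trans h1, hopcroftKerr1971_tensorRank_matMulTensor_22n_le (K := K) n⟩

/-- **The ladder `5 ≤ n ≤ 12` over every commutative ring mapping to `𝔽₃`**: exact `n = 5` (18), `n = 6` (21); windows `7` [24,25],
`8` [27,28], `9` [30,32], `10` [34,35], `11` [37,39], `12` [40,42]. -/
theorem tensorRank_matMulTensor_22n_ladder_of_ringHom_zmod3 {K : Type*} [CommRing K] (f : K →+* ZMod 3) :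
    tensorRank (matMulTensor K 2 2 5) = 18 ∧
    tensorRank (matMulTensor K 2 2 6) = 21 ∧
    tensorRank (matMulTensor K 2 2 7) ∈ Set.Icc 24 25 ∧
    tensorRank (matMulTensor K 2 2 8) ∈ Set.Icc 27 28 ∧
    tensorRank (matMulTensor K 2 2 9) ∈ Set.Icc 30 32 ∧
    tensorRank (matMulTensor K 2 2 10) ∈ Set.Icc 34 35 ∧
    tensorRank (matMulTensor K 2 2 11) ∈ Set.Icc 37 39 ∧
    tensorRank (matMulTensor K 2 2 12) ∈ Set.Icc 40 42 := by
  obtain ⟨g5, g6, g7, g8, g9, g10, g11, g12⟩ := tensorRank_matMulTensor_22n_gf3_ladder_5_12'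
  have m5 := tensorRank_matMulTensor_map_le f 2 2 5
  have m6 := tensorRank_matMulTensor_map_le f 2 2 6
  have m7 := tensorRank_matMulTensor_map_le f 2 2 7
  have m8 := tensorRank_matMulTensor_map_le f 2 2 8
  have m9 := tensorRank_matMulTensor_map_le f 2 2 9
  have m10 := tensorRank_matMulTensor_map_le f 2 2 10
  have m11 := tensorRank_matMulTensor_map_le f 2 2 11
  have m12 := tensorRank_matMulTensor_map_le f 2 2 12
  have u5 := hopcroftKerr1971_tensorRank_matMulTensor_22n_le (K := K) 5
  have u6 := hopcroftKerr1971_tensorRank_matMulTensor_22n_le (K := K) 6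
  have u7 := hopcroftKerr1971_tensorRank_matMulTensor_22n_le (K := K) 7
  have u8 := hopcroftKerr1971_tensorRank_matMulTensor_22n_le (K := K) 8
  have u9 := hopcroftKerr1971_tensorRank_matMulTensor_22n_le (K := K) 9
  have u10 := hopcroftKerr1971_tensorRank_matMulTensor_22n_le (K := K) 10
  have u11 := hopcroftKerr1971_tensorRank_matMulTensor_22n_le (K := K) 11
  have u12 := hopcroftKerr1971_tensorRank_matMulTensor_22n_le (K := K) 12
  simp only [Set.mem_Icc] at *
  omega

/-- **The dyadic ladder**: over `ℤ[1/2]` (no homomorphism to `𝔽₂`; `2 ↦ 2 ∈ 𝔽₃ˣ` gives `ℤ[1/2] → 𝔽₃`): `R(⟨2,2,5⟩) = 18`, `R(⟨2,2,6⟩) = 21`,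
`R(⟨2,2,7⟩) ∈ [24,25]`, `R(⟨2,2,8⟩) ∈ [27,28]`, `R(⟨2,2,9⟩) ∈ [30,32]`, `R(⟨2,2,10⟩) ∈ [34,35]`, `R(⟨2,2,11⟩) ∈ [37,39]`, `R(⟨2,2,12⟩) ∈ [40,42]`. -/
theorem tensorRank_matMulTensor_22n_ladder_dyadic :
    tensorRank (matMulTensor (Localization.Away (2 : ℤ)) 2 2 5) = 18 ∧
    tensorRank (matMulTensor (Localization.Away (2 : ℤ)) 2 2 6) = 21 ∧
    tensorRank (matMulTensor (Localization.Away (2 : ℤ)) 2 2 7) ∈ Set.Icc 24 25 ∧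
    tensorRank (matMulTensor (Localization.Away (2 : ℤ)) 2 2 8) ∈ Set.Icc 27 28 ∧
    tensorRank (matMulTensor (Localization.Away (2 : ℤ)) 2 2 9) ∈ Set.Icc 30 32 ∧
    tensorRank (matMulTensor (Localization.Away (2 : ℤ)) 2 2 10) ∈ Set.Icc 34 35 ∧
    tensorRank (matMulTensor (Localization.Away (2 : ℤ)) 2 2 11) ∈ Set.Icc 37 39 ∧
    tensorRank (matMulTensor (Localization.Away (2 : ℤ)) 2 2 12) ∈ Set.Icc 40 42 := by
  have h2 : IsUnit ((Int.castRingHom (ZMod 3)) 2) := by decide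
  exact tensorRank_matMulTensor_22n_ladder_of_ringHom_zmod3
    (IsLocalization.Away.lift (S := Localization.Away (2 : ℤ)) (2 : ℤ) h2)

end Summit.MatrixMultiplication.OmegaCensus.SmallFormats
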